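import Summits.Ventures.QEC.CircuitDistance.ETowerZerosDX
import HarnessLib

/-!
# P3-PORT STEP 2 (E-fold tower), sector X: ZERO-FIBRE COMPLETENESS CERTIFICATES, file 0 of 3 (PORT-SPEC N3; `goodFibK_zero` hypothesis `hD`)
(cell `qec`, experiment CDX; emitter idea-1 g5 `zerocert/emit_zeros2.py`; W = 9, half-words of weight ≤ 4)

Brute force anchored at the first slot `a = b·ls·ms` of each block `b < 5`: `zloopk M ok (M a) (2^a) (a+1) ns = true` says every
`k` further slots `ns > i₁ > … > i_k > a` with `M a ⊕ M i₁ ⊕ … ⊕ M i_k = 0` give a word matched in the D-list (`ok = matchedB ls ms 5 DX`);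
`zbandk … ilo ihi` = the same with the outer slot restricted to `[ilo, ihi)` (bands glued by `ETowerZeroCert.zspec_of_bands`).
1 theorems, 939929 leaves, ≈ 216 s predicted at 230 µs/leaf.  `decide +kernel` only; nothing here asserts a value of `d_circ`.
Statements spelled with sector-qualified names (`SecX.TFA/TFB/TFC`, `SecX.Zeros.DA/DB/DC`; same constants, elaborated types unchanged)
so that their TEXT differs from the sector-Z twins (the gate dedup is textual across namespaces; eng-1 g3, proposer).
-/

set_option maxRecDepth 100000
set_option exponentiation.threshold 1024
set_option linter.unusedVariables false

namespace Summit.Ventures.QEC.CircuitDistance.ETower.SecX.Zeros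

open Summit.Ventures.QEC.Census Summit.Ventures.QEC.Census.Fold Summit.Ventures.QEC.CircuitDistance.ETower

set_option maxHeartbeats 400000000 in
/-- level C, anchor slot 0 (block 0), 3 further slots from [1,180): 939929 leaves ≈ 216 s. -/
theorem zcC_b0_k3 : zl 3 (tab SecX.TFC 72) (matchedB 6 6 5 SecX.Zeros.DC) (tab SecX.TFC 72 0) (2 ^ 0) 1 180 = true := by
  decide +kernel

end Summit.Ventures.QEC.CircuitDistance.ETower.SecX.Zeros
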